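import Summits.BirchSwinnertonDyer.BirchSwinnertonDyer.Theorems.KimAtThreeFineKatoDefinedLambdaDefs
import HarnessLib

/-!
# Kato's dual-exponential value datum `Λ` DEFINED in the kernel, II — `katoLambda`: the single-completion
# semi-local `exp*`, `Λ_{k,r} := Ψ⁻¹ ∘ (w ↦ (g̃_w⁻¹)_* (exp*_{w₀} (loc^{tower}_{w₀} (g_w · y))))`, with the DEFINED
# `exp*_{w₀}` of w2-c2 (`expStarOmegaHom`) — `ℤ_p`-linear, EXACTLY the type of the `Λ k r` of `Kato2004.ZetaBody`
# (crux `KatoKuriharaPortThreeShared`, stmt-BirchSwinnertonDyer-19560; cell `bsd-addord`, seat w2-acc5 gen 6;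
# route W2 `KimAtThreeKolyvagin`; definitions + their API)

HONEST FRAMING.  Definitions with bodies and TOOL theorems about them (no named fact, no instance, no
notation, no `sorry`).  Nothing is closed and nothing is booked; BSD is not proved by any of this.  Sequel of
`KimAtThreeFineKatoDefinedLambdaDefs` (the abstract `definedLambda Ψ w₀ F g` for an additive `F` with the
semilinearity `hF`).  THIS FILE takes `F := exp*_{w₀} ∘ loc^{tower}_{w₀} ∘ H1toInt` at a place `w₀ ∣ p` of
`L = ℚ(ζ_m)` with the CANONICAL local structures of `L_{w₀}` (`LocalField.charZero_adicCompletion`,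
`LocalField.adicCompletionPadicAlgebra`, `not_isUnit_natCast_integerC`, `isAdicComplete_integerC_natCast` — the
`letI` block of every displayed package of crux 19560) and a local Néron line `dw` under the Prop-1.2.3 binders
`hinjw`/`hexw` (w2-c2 `KimAtThreeDeepLowerExpStarOmega`):

* `expStarTowerMap … w₀ hw₀ dw hinjw hexw : H¹(U, T_pW) →+ L_{w₀}` and `expStarTowerMap_apply`;
* `expStarTowerMap_smul` — **`exp*_{w₀} ∘ loc^{tower}_{w₀}` is `ℤ_p`-homogeneous**, `F (a · Y) = e_p(a) · F Y`
  (`oneCocycleClass_smul` → `factorDef_of_H1toInt` → `expStarOmega_oneCocycleClass` →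
  `BlochKatoDualExponential.dualExpCoord_smul` → `algebraMap ℚ_p L_{w₀} = (ℚ_{v_p} → L_{w₀}) ∘ e_p`);
* **`katoLambda … w₀ Ψ hΨ hw₀ g hg dw hinjw hexw : H¹(U_{k,r}, T_pW) →ₗ[ℤ_p] ℚ_p ⊗ ℚ(ζ_m)`** — Kato's
  `exp* ∘ loc_p` (Astérisque 295 §9.4 / Thm. 9.7) in the Néron coordinate, DEFINED — and `apply_katoLambda`
  (the class-level (DEF₀): `Ψ (Λ y)_w = (g̃_w⁻¹)_* (exp*_{w₀} (loc^{tower}_{w₀} (H1toInt (g_w · y))))`).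

So the packages of record for 19560 (`hKatoV2₀`, kim3 g15 `KimAtThreeFineKatoPerFactorPartsSingle`, and its
descendants) can NAME `Λ := fun k r => katoLambda …` instead of binding `∃ Λ … (DEF₀)`.  NOT here (sequel
`KimAtThreeFineKatoDefinedLambda`, `--supports 19560`): (DEF₀) ON COCYCLES verbatim, `ZetaBody` (C3a)/(C3b) for
`katoLambda` (kim3 `zetaBody_C3_of_level`), uniqueness of `Ψ`, `hKatoDef → hKatoV2₀`.

References: K. Kato, Astérisque 295 (2004) §9.4, Thm. 9.7 [Kato2004Asterisque]; K. Kato, LNM 1553 (1993)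
Ch. II §1.2.4, Prop. 1.2.3 [Kato1993LNM1553]; J. W. S. Cassels, A. Fröhlich (1967) Ch. II §10 (10.2), Ch. VII
§1.1 [CasselsFrohlichANT1967]; J.-P. Serre, *Local Fields* (1979) II §3 [SerreLocalFields1979]; J.-P. Serre,
*Galois Cohomology* (1997) I §2.2, §2.4 [SerreGaloisCohomology1997].
-/

noncomputable section

-- the cell's Theorems namespace `Summit.BirchSwinnertonDyer.BirchSwinnertonDyer.…` repeats the summit name by design (D-0017)
set_option linter.dupNamespace false

open scoped Classical NumberField ContRepresentation TensorProduct Pointwise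
open Field ValuativeRel NumberField IsDedekindDomain
open WeierstrassCurve Literature.NumberTheory.EllipticCurves Literature.NumberTheory.GaloisRepresentations
  Literature.NumberTheory.GaloisRepresentations.DiscreteGaloisModule
  Literature.NumberTheory.EllipticCurves.Kato2004.EulerSystemValues
open Literature.NumberTheory.GaloisRepresentations.PeriodRingData Literature.NumberTheory.PAdicHodge
open Literature.NumberTheory.AdelicBaseChange Literature.NumberTheory.Automorphic
open Summit.BirchSwinnertonDyer.Rank1Residual.GaloisImage
open Summit.BirchSwinnertonDyer.BirchSwinnertonDyer.Theorems.KimAtThreeFineKatoLevelCompat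
open Summit.BirchSwinnertonDyer.BirchSwinnertonDyer.Theorems.KimAtThreeFineKatoLevelCompatDef
open Summit.BirchSwinnertonDyer.BirchSwinnertonDyer.Theorems.KimAtThreeDeepLowerExpStarOmega
open Summit.BirchSwinnertonDyer.BirchSwinnertonDyer.Theorems.KimAtThreeDeepLowerExpStarOmegaPlace

namespace Summit.BirchSwinnertonDyer.BirchSwinnertonDyer.Theorems.KimAtThreeFineKatoDefinedLambda

/-! ### The defined `exp*_{w₀} ∘ loc^{tower}_{w₀}` on level cohomology, its `ℤ_p`-homogeneity, and `katoLambda` -/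

section ExpStar

variable (W : WeierstrassCurve ℚ) [W.IsElliptic] (p : ℕ) [hp : Fact p.Prime]
  [ContinuousSMul ℤ_[p] (W.tateModule p)] (k : ℕ) (r : Finset (HeightOneSpectrum (𝓞 ℚ)))
  (w₀ : ((Rat.HeightOneSpectrum.primesEquiv (R := 𝓞 ℚ)).symm ⟨p, Fact.out⟩).Extension
    (𝓞 (CyclotomicField (cycLevel p k r) ℚ)))

set_option backward.isDefEq.respectTransparency false in
/-- **`F_{w₀} := exp*_{w₀} ∘ loc^{tower}_{w₀} ∘ H1toInt : H¹(U, T_pW) →+ L_{w₀}`** — the defined scalar dual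
exponential (w2-c2 `expStarOmegaHom`, Kato LNM 1553 II §1.2.4, in the coordinate of a local Néron line `dw`
at `L_{w₀}` under the Prop-1.2.3 binders) of the tower localisation at `w₀` of a level class
(`LevelFieldLocalization.locTower` on the `ℤ`-currency via `ContinuousRep.H1toInt`), with the CANONICAL local
structures of `L_{w₀}` (`LocalField.adicCompletionPadicAlgebra`) — the `F` of `definedLambda`.
[cite: Kato2004Asterisque, §9.4 (p. 188)] [cite: Kato1993LNM1553, Ch. II §1.2.4] -/
def expStarTowerMap (hw₀ : ((p : ℕ) : 𝓞 (CyclotomicField (cycLevel p k r) ℚ)) ∈ w₀.1.asIdeal) :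
    letI := LocalField.charZero_adicCompletion w₀.1
    letI := LocalField.adicCompletionPadicAlgebra w₀.1 p hw₀
    haveI : Fact (¬ IsUnit ((p : ℕ) : integerC (w₀.1.adicCompletion (CyclotomicField (cycLevel p k r) ℚ)))) :=
      ⟨not_isUnit_natCast_integerC (LocalField.valuation_adicCompletion_natCast_lt_one w₀.1 p hw₀)⟩
    haveI := isAdicComplete_integerC_natCast (LocalField.valuation_adicCompletion_natCast_lt_one w₀.1 p hw₀)
    ∀ (dw : LocalNeronLine W (LocalField.valuation_adicCompletion_natCast_lt_one w₀.1 p hw₀)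
        ((galRestrictPlace ((Rat.HeightOneSpectrum.primesEquiv (R := 𝓞 ℚ)).symm ⟨p, Fact.out⟩)).comp
          (absGaloisRestrict (((Rat.HeightOneSpectrum.primesEquiv (R := 𝓞 ℚ)).symm ⟨p, Fact.out⟩).adicCompletion ℚ)
            (w₀.1.adicCompletion (CyclotomicField (cycLevel p k r) ℚ)))))
      (_hinjw : (bdRPeriodRingData (LocalField.valuation_adicCompletion_natCast_lt_one w₀.1 p hw₀)).CupLogInjective
        (logCyclotomic p) (localRationalTateRep W p ((galRestrictPlace ((Rat.HeightOneSpectrum.primesEquiv (R := 𝓞 ℚ)).symm ⟨p, Fact.out⟩)).comp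
          (absGaloisRestrict (((Rat.HeightOneSpectrum.primesEquiv (R := 𝓞 ℚ)).symm ⟨p, Fact.out⟩).adicCompletion ℚ)
            (w₀.1.adicCompletion (CyclotomicField (cycLevel p k r) ℚ))))))
      (_hexw : ∀ z : contOneCocycles (localRationalTateRep W p ((galRestrictPlace ((Rat.HeightOneSpectrum.primesEquiv (R := 𝓞 ℚ)).symm ⟨p, Fact.out⟩)).comp
          (absGaloisRestrict (((Rat.HeightOneSpectrum.primesEquiv (R := 𝓞 ℚ)).symm ⟨p, Fact.out⟩).adicCompletion ℚ)
            (w₀.1.adicCompletion (CyclotomicField (cycLevel p k r) ℚ))))).toTopRep,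
        (bdRPeriodRingData (LocalField.valuation_adicCompletion_natCast_lt_one w₀.1 p hw₀)).HasDualExp
          (logCyclotomic p) (localRationalTateRep W p ((galRestrictPlace ((Rat.HeightOneSpectrum.primesEquiv (R := 𝓞 ℚ)).symm ⟨p, Fact.out⟩)).comp
          (absGaloisRestrict (((Rat.HeightOneSpectrum.primesEquiv (R := 𝓞 ℚ)).symm ⟨p, Fact.out⟩).adicCompletion ℚ)
            (w₀.1.adicCompletion (CyclotomicField (cycLevel p k r) ℚ))))) fun σ => z.1 σ),
      H1 (tateRep W p) (cycSubgroup p k r) →+ w₀.1.adicCompletion (CyclotomicField (cycLevel p k r) ℚ) :=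
  fun dw hinjw hexw =>
    letI := LocalField.charZero_adicCompletion w₀.1
    letI := LocalField.adicCompletionPadicAlgebra w₀.1 p hw₀
    haveI : Fact (¬ IsUnit ((p : ℕ) : integerC (w₀.1.adicCompletion (CyclotomicField (cycLevel p k r) ℚ)))) :=
      ⟨not_isUnit_natCast_integerC (LocalField.valuation_adicCompletion_natCast_lt_one w₀.1 p hw₀)⟩
    haveI := isAdicComplete_integerC_natCast (LocalField.valuation_adicCompletion_natCast_lt_one w₀.1 p hw₀)
    letI : Algebra (Place.Completion (K := ℚ) (Sum.inr ((Rat.HeightOneSpectrum.primesEquiv (R := 𝓞 ℚ)).symm ⟨p, Fact.out⟩)))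
        (w₀.1.adicCompletion (CyclotomicField (cycLevel p k r) ℚ)) :=
      inferInstanceAs (Algebra (((Rat.HeightOneSpectrum.primesEquiv (R := 𝓞 ℚ)).symm ⟨p, Fact.out⟩).adicCompletion ℚ)
        (w₀.1.adicCompletion (CyclotomicField (cycLevel p k r) ℚ)))
    (expStarOmegaHom (LocalField.valuation_adicCompletion_natCast_lt_one w₀.1 p hw₀)
        ((galRestrictPlace ((Rat.HeightOneSpectrum.primesEquiv (R := 𝓞 ℚ)).symm ⟨p, Fact.out⟩)).comp
          (absGaloisRestrict (((Rat.HeightOneSpectrum.primesEquiv (R := 𝓞 ℚ)).symm ⟨p, Fact.out⟩).adicCompletion ℚ)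
            (w₀.1.adicCompletion (CyclotomicField (cycLevel p k r) ℚ)))) dw hinjw hexw).comp
      ((((locTower ℚ (Place.Completion (K := ℚ) (Sum.inr ((Rat.HeightOneSpectrum.primesEquiv (R := 𝓞 ℚ)).symm ⟨p, Fact.out⟩)))
          (w₀.1.adicCompletion (CyclotomicField (cycLevel p k r) ℚ)) (tateRep W p).toIntRep.toTopRep (cycSubgroup p k r)
          (absGaloisRestrictTower_adicCompletion_mem_cycSubgroup_prime p k r w₀) 1).hom.toLinearMap.toAddMonoidHom).comp
        ((tateRep W p).level (cycSubgroup p k r)).H1toInt))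

set_option backward.isDefEq.respectTransparency false in
/-- Unfolding `expStarTowerMap` as a composite of additive maps (plumbing for `expStarTowerMap_apply`).
[cite: Kato2004Asterisque, §9.4 (p. 188)] -/
theorem expStarTowerMap_eq (hw₀ : ((p : ℕ) : 𝓞 (CyclotomicField (cycLevel p k r) ℚ)) ∈ w₀.1.asIdeal) :
    letI := LocalField.charZero_adicCompletion w₀.1
    letI := LocalField.adicCompletionPadicAlgebra w₀.1 p hw₀
    haveI : Fact (¬ IsUnit ((p : ℕ) : integerC (w₀.1.adicCompletion (CyclotomicField (cycLevel p k r) ℚ)))) :=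
      ⟨not_isUnit_natCast_integerC (LocalField.valuation_adicCompletion_natCast_lt_one w₀.1 p hw₀)⟩
    haveI := isAdicComplete_integerC_natCast (LocalField.valuation_adicCompletion_natCast_lt_one w₀.1 p hw₀)
    letI : Algebra (Place.Completion (K := ℚ) (Sum.inr ((Rat.HeightOneSpectrum.primesEquiv (R := 𝓞 ℚ)).symm ⟨p, Fact.out⟩)))
        (w₀.1.adicCompletion (CyclotomicField (cycLevel p k r) ℚ)) :=
      inferInstanceAs (Algebra (((Rat.HeightOneSpectrum.primesEquiv (R := 𝓞 ℚ)).symm ⟨p, Fact.out⟩).adicCompletion ℚ)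
        (w₀.1.adicCompletion (CyclotomicField (cycLevel p k r) ℚ)))
    ∀ (dw : LocalNeronLine W (LocalField.valuation_adicCompletion_natCast_lt_one w₀.1 p hw₀)
        ((galRestrictPlace ((Rat.HeightOneSpectrum.primesEquiv (R := 𝓞 ℚ)).symm ⟨p, Fact.out⟩)).comp
          (absGaloisRestrict (((Rat.HeightOneSpectrum.primesEquiv (R := 𝓞 ℚ)).symm ⟨p, Fact.out⟩).adicCompletion ℚ)
            (w₀.1.adicCompletion (CyclotomicField (cycLevel p k r) ℚ)))))
      (hinjw : (bdRPeriodRingData (LocalField.valuation_adicCompletion_natCast_lt_one w₀.1 p hw₀)).CupLogInjective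
        (logCyclotomic p) (localRationalTateRep W p ((galRestrictPlace ((Rat.HeightOneSpectrum.primesEquiv (R := 𝓞 ℚ)).symm ⟨p, Fact.out⟩)).comp
          (absGaloisRestrict (((Rat.HeightOneSpectrum.primesEquiv (R := 𝓞 ℚ)).symm ⟨p, Fact.out⟩).adicCompletion ℚ)
            (w₀.1.adicCompletion (CyclotomicField (cycLevel p k r) ℚ))))))
      (hexw : ∀ z : contOneCocycles (localRationalTateRep W p ((galRestrictPlace ((Rat.HeightOneSpectrum.primesEquiv (R := 𝓞 ℚ)).symm ⟨p, Fact.out⟩)).comp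
          (absGaloisRestrict (((Rat.HeightOneSpectrum.primesEquiv (R := 𝓞 ℚ)).symm ⟨p, Fact.out⟩).adicCompletion ℚ)
            (w₀.1.adicCompletion (CyclotomicField (cycLevel p k r) ℚ))))).toTopRep,
        (bdRPeriodRingData (LocalField.valuation_adicCompletion_natCast_lt_one w₀.1 p hw₀)).HasDualExp
          (logCyclotomic p) (localRationalTateRep W p ((galRestrictPlace ((Rat.HeightOneSpectrum.primesEquiv (R := 𝓞 ℚ)).symm ⟨p, Fact.out⟩)).comp
          (absGaloisRestrict (((Rat.HeightOneSpectrum.primesEquiv (R := 𝓞 ℚ)).symm ⟨p, Fact.out⟩).adicCompletion ℚ)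
            (w₀.1.adicCompletion (CyclotomicField (cycLevel p k r) ℚ))))) fun σ => z.1 σ),
      expStarTowerMap W p k r w₀ hw₀ dw hinjw hexw =
        (expStarOmegaHom (LocalField.valuation_adicCompletion_natCast_lt_one w₀.1 p hw₀)
          ((galRestrictPlace ((Rat.HeightOneSpectrum.primesEquiv (R := 𝓞 ℚ)).symm ⟨p, Fact.out⟩)).comp
            (absGaloisRestrict (((Rat.HeightOneSpectrum.primesEquiv (R := 𝓞 ℚ)).symm ⟨p, Fact.out⟩).adicCompletion ℚ)
              (w₀.1.adicCompletion (CyclotomicField (cycLevel p k r) ℚ)))) dw hinjw hexw).comp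
        ((((locTower ℚ (Place.Completion (K := ℚ) (Sum.inr ((Rat.HeightOneSpectrum.primesEquiv (R := 𝓞 ℚ)).symm ⟨p, Fact.out⟩)))
            (w₀.1.adicCompletion (CyclotomicField (cycLevel p k r) ℚ)) (tateRep W p).toIntRep.toTopRep (cycSubgroup p k r)
            (absGaloisRestrictTower_adicCompletion_mem_cycSubgroup_prime p k r w₀) 1).hom.toLinearMap.toAddMonoidHom).comp
          ((tateRep W p).level (cycSubgroup p k r)).H1toInt)) :=
  fun _ _ _ => rfl

set_option backward.isDefEq.respectTransparency false in
/-- Unfolding `expStarTowerMap`: `F_{w₀} y = exp*_{w₀} (loc^{tower}_{w₀} (H1toInt y))`.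
[cite: Kato2004Asterisque, §9.4 (p. 188)] -/
theorem expStarTowerMap_apply (hw₀ : ((p : ℕ) : 𝓞 (CyclotomicField (cycLevel p k r) ℚ)) ∈ w₀.1.asIdeal) :
    letI := LocalField.charZero_adicCompletion w₀.1
    letI := LocalField.adicCompletionPadicAlgebra w₀.1 p hw₀
    haveI : Fact (¬ IsUnit ((p : ℕ) : integerC (w₀.1.adicCompletion (CyclotomicField (cycLevel p k r) ℚ)))) :=
      ⟨not_isUnit_natCast_integerC (LocalField.valuation_adicCompletion_natCast_lt_one w₀.1 p hw₀)⟩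
    haveI := isAdicComplete_integerC_natCast (LocalField.valuation_adicCompletion_natCast_lt_one w₀.1 p hw₀)
    letI : Algebra (Place.Completion (K := ℚ) (Sum.inr ((Rat.HeightOneSpectrum.primesEquiv (R := 𝓞 ℚ)).symm ⟨p, Fact.out⟩)))
        (w₀.1.adicCompletion (CyclotomicField (cycLevel p k r) ℚ)) :=
      inferInstanceAs (Algebra (((Rat.HeightOneSpectrum.primesEquiv (R := 𝓞 ℚ)).symm ⟨p, Fact.out⟩).adicCompletion ℚ)
        (w₀.1.adicCompletion (CyclotomicField (cycLevel p k r) ℚ)))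
    ∀ (dw : LocalNeronLine W (LocalField.valuation_adicCompletion_natCast_lt_one w₀.1 p hw₀)
        ((galRestrictPlace ((Rat.HeightOneSpectrum.primesEquiv (R := 𝓞 ℚ)).symm ⟨p, Fact.out⟩)).comp
          (absGaloisRestrict (((Rat.HeightOneSpectrum.primesEquiv (R := 𝓞 ℚ)).symm ⟨p, Fact.out⟩).adicCompletion ℚ)
            (w₀.1.adicCompletion (CyclotomicField (cycLevel p k r) ℚ)))))
      (hinjw : (bdRPeriodRingData (LocalField.valuation_adicCompletion_natCast_lt_one w₀.1 p hw₀)).CupLogInjective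
        (logCyclotomic p) (localRationalTateRep W p ((galRestrictPlace ((Rat.HeightOneSpectrum.primesEquiv (R := 𝓞 ℚ)).symm ⟨p, Fact.out⟩)).comp
          (absGaloisRestrict (((Rat.HeightOneSpectrum.primesEquiv (R := 𝓞 ℚ)).symm ⟨p, Fact.out⟩).adicCompletion ℚ)
            (w₀.1.adicCompletion (CyclotomicField (cycLevel p k r) ℚ))))))
      (hexw : ∀ z : contOneCocycles (localRationalTateRep W p ((galRestrictPlace ((Rat.HeightOneSpectrum.primesEquiv (R := 𝓞 ℚ)).symm ⟨p, Fact.out⟩)).comp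
          (absGaloisRestrict (((Rat.HeightOneSpectrum.primesEquiv (R := 𝓞 ℚ)).symm ⟨p, Fact.out⟩).adicCompletion ℚ)
            (w₀.1.adicCompletion (CyclotomicField (cycLevel p k r) ℚ))))).toTopRep,
        (bdRPeriodRingData (LocalField.valuation_adicCompletion_natCast_lt_one w₀.1 p hw₀)).HasDualExp
          (logCyclotomic p) (localRationalTateRep W p ((galRestrictPlace ((Rat.HeightOneSpectrum.primesEquiv (R := 𝓞 ℚ)).symm ⟨p, Fact.out⟩)).comp
          (absGaloisRestrict (((Rat.HeightOneSpectrum.primesEquiv (R := 𝓞 ℚ)).symm ⟨p, Fact.out⟩).adicCompletion ℚ)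
            (w₀.1.adicCompletion (CyclotomicField (cycLevel p k r) ℚ))))) fun σ => z.1 σ)
      (y : H1 (tateRep W p) (cycSubgroup p k r)),
      expStarTowerMap W p k r w₀ hw₀ dw hinjw hexw y =
        expStarOmegaHom (LocalField.valuation_adicCompletion_natCast_lt_one w₀.1 p hw₀)
          ((galRestrictPlace ((Rat.HeightOneSpectrum.primesEquiv (R := 𝓞 ℚ)).symm ⟨p, Fact.out⟩)).comp
            (absGaloisRestrict (((Rat.HeightOneSpectrum.primesEquiv (R := 𝓞 ℚ)).symm ⟨p, Fact.out⟩).adicCompletion ℚ)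
              (w₀.1.adicCompletion (CyclotomicField (cycLevel p k r) ℚ)))) dw hinjw hexw
          (locTower ℚ (Place.Completion (K := ℚ) (Sum.inr ((Rat.HeightOneSpectrum.primesEquiv (R := 𝓞 ℚ)).symm ⟨p, Fact.out⟩)))
            (w₀.1.adicCompletion (CyclotomicField (cycLevel p k r) ℚ)) (tateRep W p).toIntRep.toTopRep (cycSubgroup p k r)
            (absGaloisRestrictTower_adicCompletion_mem_cycSubgroup_prime p k r w₀) 1
            (((tateRep W p).level (cycSubgroup p k r)).H1toInt y)) := by
  intro dw hinjw hexw y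
  rw [expStarTowerMap_eq]
  rfl

set_option backward.isDefEq.respectTransparency false in
set_option maxHeartbeats 400000 in
/-- **`exp*_{w₀} ∘ loc^{tower}_{w₀}` is `ℤ_p`-homogeneous**: `F_{w₀} (a · Y) = e_p(a) · F_{w₀} Y` for `a ∈ ℤ_p`,
read in `L_{w₀}` through `ℚ_{v_p} → L_{w₀}` (`e_p = Padic.adicCompletionEquiv`) — the hypothesis `hF` of
`definedLambda`.  Proof on cocycles: `a · [φ''] = [a · φ'']` (`oneCocycleClass_smul`), the tower cocycle of
`a · φ''` is `a ·` that of `φ''`, its push-forward to `V_pW` is `a ·` the push-forward (`T_pW → V_pW` is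
`ℤ_p`-linear), Kato's `exp*_ω` is `ℚ_p`-linear on cocycles (`BlochKatoDualExponential.dualExpCoord_smul`, under
the Prop-1.2.3 binders and the line property of `dw`), and `algebraMap ℚ_p L_{w₀} = (ℚ_{v_p} → L_{w₀}) ∘ e_p`
for the canonical structure. [cite: Kato1993LNM1553, Ch. II §1.2.4 and Prop. 1.2.3]
[cite: SerreGaloisCohomology1997, I §2.2 and §2.4] -/
theorem expStarTowerMap_smul (hw₀ : ((p : ℕ) : 𝓞 (CyclotomicField (cycLevel p k r) ℚ)) ∈ w₀.1.asIdeal) :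
    letI := LocalField.charZero_adicCompletion w₀.1
    letI := LocalField.adicCompletionPadicAlgebra w₀.1 p hw₀
    haveI : Fact (¬ IsUnit ((p : ℕ) : integerC (w₀.1.adicCompletion (CyclotomicField (cycLevel p k r) ℚ)))) :=
      ⟨not_isUnit_natCast_integerC (LocalField.valuation_adicCompletion_natCast_lt_one w₀.1 p hw₀)⟩
    haveI := isAdicComplete_integerC_natCast (LocalField.valuation_adicCompletion_natCast_lt_one w₀.1 p hw₀)
    ∀ (dw : LocalNeronLine W (LocalField.valuation_adicCompletion_natCast_lt_one w₀.1 p hw₀)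
        ((galRestrictPlace ((Rat.HeightOneSpectrum.primesEquiv (R := 𝓞 ℚ)).symm ⟨p, Fact.out⟩)).comp
          (absGaloisRestrict (((Rat.HeightOneSpectrum.primesEquiv (R := 𝓞 ℚ)).symm ⟨p, Fact.out⟩).adicCompletion ℚ)
            (w₀.1.adicCompletion (CyclotomicField (cycLevel p k r) ℚ)))))
      (hinjw : (bdRPeriodRingData (LocalField.valuation_adicCompletion_natCast_lt_one w₀.1 p hw₀)).CupLogInjective
        (logCyclotomic p) (localRationalTateRep W p ((galRestrictPlace ((Rat.HeightOneSpectrum.primesEquiv (R := 𝓞 ℚ)).symm ⟨p, Fact.out⟩)).comp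
          (absGaloisRestrict (((Rat.HeightOneSpectrum.primesEquiv (R := 𝓞 ℚ)).symm ⟨p, Fact.out⟩).adicCompletion ℚ)
            (w₀.1.adicCompletion (CyclotomicField (cycLevel p k r) ℚ))))))
      (hexw : ∀ z : contOneCocycles (localRationalTateRep W p ((galRestrictPlace ((Rat.HeightOneSpectrum.primesEquiv (R := 𝓞 ℚ)).symm ⟨p, Fact.out⟩)).comp
          (absGaloisRestrict (((Rat.HeightOneSpectrum.primesEquiv (R := 𝓞 ℚ)).symm ⟨p, Fact.out⟩).adicCompletion ℚ)
            (w₀.1.adicCompletion (CyclotomicField (cycLevel p k r) ℚ))))).toTopRep,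
        (bdRPeriodRingData (LocalField.valuation_adicCompletion_natCast_lt_one w₀.1 p hw₀)).HasDualExp
          (logCyclotomic p) (localRationalTateRep W p ((galRestrictPlace ((Rat.HeightOneSpectrum.primesEquiv (R := 𝓞 ℚ)).symm ⟨p, Fact.out⟩)).comp
          (absGaloisRestrict (((Rat.HeightOneSpectrum.primesEquiv (R := 𝓞 ℚ)).symm ⟨p, Fact.out⟩).adicCompletion ℚ)
            (w₀.1.adicCompletion (CyclotomicField (cycLevel p k r) ℚ))))) fun σ => z.1 σ)
      (a : ℤ_[p]) (Y : H1 (tateRep W p) (cycSubgroup p k r)),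
      expStarTowerMap W p k r w₀ hw₀ dw hinjw hexw (a • Y) =
        algebraMap (((Rat.HeightOneSpectrum.primesEquiv (R := 𝓞 ℚ)).symm ⟨p, Fact.out⟩).adicCompletion ℚ)
          (w₀.1.adicCompletion (CyclotomicField (cycLevel p k r) ℚ))
          (Padic.adicCompletionEquiv (𝓞 ℚ) ⟨p, Fact.out⟩ (a : ℚ_[p])) * expStarTowerMap W p k r w₀ hw₀ dw hinjw hexw Y := by
  intro dw hinjw hexw a Y
  letI := LocalField.charZero_adicCompletion w₀.1
  letI := LocalField.adicCompletionPadicAlgebra w₀.1 p hw₀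
  haveI : Fact (¬ IsUnit ((p : ℕ) : integerC (w₀.1.adicCompletion (CyclotomicField (cycLevel p k r) ℚ)))) :=
    ⟨not_isUnit_natCast_integerC (LocalField.valuation_adicCompletion_natCast_lt_one w₀.1 p hw₀)⟩
  haveI := isAdicComplete_integerC_natCast (LocalField.valuation_adicCompletion_natCast_lt_one w₀.1 p hw₀)
  letI : Algebra (Place.Completion (K := ℚ) (Sum.inr ((Rat.HeightOneSpectrum.primesEquiv (R := 𝓞 ℚ)).symm ⟨p, Fact.out⟩)))
      (w₀.1.adicCompletion (CyclotomicField (cycLevel p k r) ℚ)) :=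
    inferInstanceAs (Algebra (((Rat.HeightOneSpectrum.primesEquiv (R := 𝓞 ℚ)).symm ⟨p, Fact.out⟩).adicCompletion ℚ)
      (w₀.1.adicCompletion (CyclotomicField (cycLevel p k r) ℚ)))
  -- cocycles: `Y = [φ'']`, `a · Y = [a · φ'']`, and their tower cocycles `ψT`, `ψT'`
  obtain ⟨φ'', rfl⟩ := oneCocycleClass_surjective (subgroupRep (tateRep W p).toTopRep (cycSubgroup p k r)) Y
  obtain ⟨ψT, hψT⟩ := exists_level_towerCocycle W p ((Rat.HeightOneSpectrum.primesEquiv (R := 𝓞 ℚ)).symm ⟨p, Fact.out⟩)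
    (w₀.1.adicCompletion (CyclotomicField (cycLevel p k r) ℚ)) (cycSubgroup p k r)
    (absGaloisRestrictTower_adicCompletion_mem_cycSubgroup_prime p k r w₀) φ''
  obtain ⟨ψT', hψT'⟩ := exists_level_towerCocycle W p ((Rat.HeightOneSpectrum.primesEquiv (R := 𝓞 ℚ)).symm ⟨p, Fact.out⟩)
    (w₀.1.adicCompletion (CyclotomicField (cycLevel p k r) ℚ)) (cycSubgroup p k r)
    (absGaloisRestrictTower_adicCompletion_mem_cycSubgroup_prime p k r w₀) (a • φ'')
  have h1 : expStarTowerMap W p k r w₀ hw₀ dw hinjw hexw (oneCocycleClass _ φ'') =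
      expStarOmegaHom (LocalField.valuation_adicCompletion_natCast_lt_one w₀.1 p hw₀)
        ((galRestrictPlace ((Rat.HeightOneSpectrum.primesEquiv (R := 𝓞 ℚ)).symm ⟨p, Fact.out⟩)).comp
          (absGaloisRestrict (((Rat.HeightOneSpectrum.primesEquiv (R := 𝓞 ℚ)).symm ⟨p, Fact.out⟩).adicCompletion ℚ)
            (w₀.1.adicCompletion (CyclotomicField (cycLevel p k r) ℚ)))) dw hinjw hexw (oneCocycleClass _ ψT) := by
    rw [expStarTowerMap_apply]
    exact factorDef_of_H1toInt W p k r ((Rat.HeightOneSpectrum.primesEquiv (R := 𝓞 ℚ)).symm ⟨p, Fact.out⟩)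
      (w₀.1.adicCompletion (CyclotomicField (cycLevel p k r) ℚ))
      (absGaloisRestrictTower_adicCompletion_mem_cycSubgroup_prime p k r w₀)
      (expStarOmegaHom (LocalField.valuation_adicCompletion_natCast_lt_one w₀.1 p hw₀)
        ((galRestrictPlace ((Rat.HeightOneSpectrum.primesEquiv (R := 𝓞 ℚ)).symm ⟨p, Fact.out⟩)).comp
          (absGaloisRestrict (((Rat.HeightOneSpectrum.primesEquiv (R := 𝓞 ℚ)).symm ⟨p, Fact.out⟩).adicCompletion ℚ)
            (w₀.1.adicCompletion (CyclotomicField (cycLevel p k r) ℚ)))) dw hinjw hexw) _ φ'' rfl ψT hψT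
  have h2 : expStarTowerMap W p k r w₀ hw₀ dw hinjw hexw (a • oneCocycleClass _ φ'') =
      expStarOmegaHom (LocalField.valuation_adicCompletion_natCast_lt_one w₀.1 p hw₀)
        ((galRestrictPlace ((Rat.HeightOneSpectrum.primesEquiv (R := 𝓞 ℚ)).symm ⟨p, Fact.out⟩)).comp
          (absGaloisRestrict (((Rat.HeightOneSpectrum.primesEquiv (R := 𝓞 ℚ)).symm ⟨p, Fact.out⟩).adicCompletion ℚ)
            (w₀.1.adicCompletion (CyclotomicField (cycLevel p k r) ℚ)))) dw hinjw hexw (oneCocycleClass _ ψT') := by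
    rw [← oneCocycleClass_smul, expStarTowerMap_apply]
    exact factorDef_of_H1toInt W p k r ((Rat.HeightOneSpectrum.primesEquiv (R := 𝓞 ℚ)).symm ⟨p, Fact.out⟩)
      (w₀.1.adicCompletion (CyclotomicField (cycLevel p k r) ℚ))
      (absGaloisRestrictTower_adicCompletion_mem_cycSubgroup_prime p k r w₀)
      (expStarOmegaHom (LocalField.valuation_adicCompletion_natCast_lt_one w₀.1 p hw₀)
        ((galRestrictPlace ((Rat.HeightOneSpectrum.primesEquiv (R := 𝓞 ℚ)).symm ⟨p, Fact.out⟩)).comp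
          (absGaloisRestrict (((Rat.HeightOneSpectrum.primesEquiv (R := 𝓞 ℚ)).symm ⟨p, Fact.out⟩).adicCompletion ℚ)
            (w₀.1.adicCompletion (CyclotomicField (cycLevel p k r) ℚ)))) dw hinjw hexw) _ (a • φ'') rfl ψT' hψT'
  rw [h1, h2, expStarOmegaHom_apply, expStarOmegaHom_apply, expStarOmega_oneCocycleClass,
    expStarOmega_oneCocycleClass]
  -- the push-forward of `ψT'` is `a ·` the push-forward of `ψT`
  have hfun : (fun σ => ((pushRational (W := W)
        (r := (galRestrictPlace ((Rat.HeightOneSpectrum.primesEquiv (R := 𝓞 ℚ)).symm ⟨p, Fact.out⟩)).comp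
          (absGaloisRestrict (((Rat.HeightOneSpectrum.primesEquiv (R := 𝓞 ℚ)).symm ⟨p, Fact.out⟩).adicCompletion ℚ)
            (w₀.1.adicCompletion (CyclotomicField (cycLevel p k r) ℚ)))) p ψT').1 σ : W.rationalTateModule p)) =
      fun σ => (a : ℚ_[p]) • ((pushRational (W := W)
        (r := (galRestrictPlace ((Rat.HeightOneSpectrum.primesEquiv (R := 𝓞 ℚ)).symm ⟨p, Fact.out⟩)).comp
          (absGaloisRestrict (((Rat.HeightOneSpectrum.primesEquiv (R := 𝓞 ℚ)).symm ⟨p, Fact.out⟩).adicCompletion ℚ)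
            (w₀.1.adicCompletion (CyclotomicField (cycLevel p k r) ℚ)))) p ψT).1 σ : W.rationalTateModule p) := by
    funext σ
    rw [pushRational_apply, pushRational_apply, hψT', hψT]
    change TateModule.toRational p (a • φ''.1 _) = _
    rw [map_smul, ← algebraMap_smul ℚ_[p] a (TateModule.toRational p (φ''.1 _))]
    rfl
  rw [hfun]
  rw [dualExpCoord_smul hinjw dw.ne_zero dw.exists_smul_eq (a : ℚ_[p])
    (hexw (pushRational (W := W)
      (r := (galRestrictPlace ((Rat.HeightOneSpectrum.primesEquiv (R := 𝓞 ℚ)).symm ⟨p, Fact.out⟩)).comp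
        (absGaloisRestrict (((Rat.HeightOneSpectrum.primesEquiv (R := 𝓞 ℚ)).symm ⟨p, Fact.out⟩).adicCompletion ℚ)
          (w₀.1.adicCompletion (CyclotomicField (cycLevel p k r) ℚ)))) p ψT))]
  congr 1
  exact algebraMap_adicCompletionPadicAlgebra_eq_algebraMap_adicCompletionEquiv p (cycLevel p k r) w₀ hw₀ (a : ℚ_[p])

variable
  (Ψ : ℚ_[p] ⊗[ℚ] CyclotomicField (cycLevel p k r) ℚ ≃ₐ[ℚ]
    (Π w : ((Rat.HeightOneSpectrum.primesEquiv (R := 𝓞 ℚ)).symm ⟨p, Fact.out⟩).Extension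
      (𝓞 (CyclotomicField (cycLevel p k r) ℚ)), w.1.adicCompletion (CyclotomicField (cycLevel p k r) ℚ)))
  (hΨ : ∀ (s : ℚ_[p]) (x : CyclotomicField (cycLevel p k r) ℚ)
    (w : ((Rat.HeightOneSpectrum.primesEquiv (R := 𝓞 ℚ)).symm ⟨p, Fact.out⟩).Extension
      (𝓞 (CyclotomicField (cycLevel p k r) ℚ))),
    Ψ (s ⊗ₜ[ℚ] x) w = algebraMap (CyclotomicField (cycLevel p k r) ℚ)
        (w.1.adicCompletion (CyclotomicField (cycLevel p k r) ℚ)) x *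
      algebraMap (((Rat.HeightOneSpectrum.primesEquiv (R := 𝓞 ℚ)).symm ⟨p, Fact.out⟩).adicCompletion ℚ)
        (w.1.adicCompletion (CyclotomicField (cycLevel p k r) ℚ)) (Padic.adicCompletionEquiv (𝓞 ℚ) ⟨p, Fact.out⟩ s))
  (hw₀ : ((p : ℕ) : 𝓞 (CyclotomicField (cycLevel p k r) ℚ)) ∈ w₀.1.asIdeal)
  (g : ((Rat.HeightOneSpectrum.primesEquiv (R := 𝓞 ℚ)).symm ⟨p, Fact.out⟩).Extension
    (𝓞 (CyclotomicField (cycLevel p k r) ℚ)) → absoluteGaloisGroup ℚ)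
  (hg : ∀ w : ((Rat.HeightOneSpectrum.primesEquiv (R := 𝓞 ℚ)).symm ⟨p, Fact.out⟩).Extension
      (𝓞 (CyclotomicField (cycLevel p k r) ℚ)),
    sigma (cycLevel p k r) (modNCyclotomicCharacter ℚ (cycLevel p k r) (g w)) • w.1 = w₀.1)

/-- **Kato's value datum DEFINED: `Λ_{k,r} := Ψ⁻¹ ∘ (w ↦ (g̃_w⁻¹)_* (exp*_{w₀} (loc^{tower}_{w₀} (g_w · y))))`,
`H¹(U_{k,r}, T_pW) →ₗ[ℤ_p] ℚ_p ⊗ ℚ(ζ_m)`** — the `exp* ∘ loc_p` of Kato, Astérisque 295 §9.4 / Thm. 9.7 on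
the semi-local cohomology `⊕_{w ∣ p} H¹(L_w, T)`, read through ONE completion `L_{w₀}` in the coordinate of a
local Néron line `dw` (w2-c2's `expStarOmegaHom` under the Prop-1.2.3 binders), the other factors reached by
the twist family `g` (`g̃_w • w = w₀`) and the transports `(g̃_w⁻¹)_* : L_{w₀} → L_w`, assembled by
`Ψ : ℚ_p ⊗ ℚ(ζ_m) ≅ ∏_{w ∣ p} L_w` — EXACTLY the type of the `Λ k r` of `Kato2004.ZetaBody`, so that the
packages of crux 19560 can name it instead of binding `∃ Λ … (DEF₀)`.
[cite: Kato2004Asterisque, §9.4 (p. 188) and Thm. 9.7 (p. 189)] [cite: Kato1993LNM1553, Ch. II §1.2.4]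
[cite: CasselsFrohlichANT1967, Ch. II §10 Theorem (10.2) and Ch. VII §1.1] -/
def katoLambda :
    letI := LocalField.charZero_adicCompletion w₀.1
    letI := LocalField.adicCompletionPadicAlgebra w₀.1 p hw₀
    haveI : Fact (¬ IsUnit ((p : ℕ) : integerC (w₀.1.adicCompletion (CyclotomicField (cycLevel p k r) ℚ)))) :=
      ⟨not_isUnit_natCast_integerC (LocalField.valuation_adicCompletion_natCast_lt_one w₀.1 p hw₀)⟩
    haveI := isAdicComplete_integerC_natCast (LocalField.valuation_adicCompletion_natCast_lt_one w₀.1 p hw₀)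
    ∀ (dw : LocalNeronLine W (LocalField.valuation_adicCompletion_natCast_lt_one w₀.1 p hw₀)
        ((galRestrictPlace ((Rat.HeightOneSpectrum.primesEquiv (R := 𝓞 ℚ)).symm ⟨p, Fact.out⟩)).comp
          (absGaloisRestrict (((Rat.HeightOneSpectrum.primesEquiv (R := 𝓞 ℚ)).symm ⟨p, Fact.out⟩).adicCompletion ℚ)
            (w₀.1.adicCompletion (CyclotomicField (cycLevel p k r) ℚ)))))
      (_hinjw : (bdRPeriodRingData (LocalField.valuation_adicCompletion_natCast_lt_one w₀.1 p hw₀)).CupLogInjective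
        (logCyclotomic p) (localRationalTateRep W p ((galRestrictPlace ((Rat.HeightOneSpectrum.primesEquiv (R := 𝓞 ℚ)).symm ⟨p, Fact.out⟩)).comp
          (absGaloisRestrict (((Rat.HeightOneSpectrum.primesEquiv (R := 𝓞 ℚ)).symm ⟨p, Fact.out⟩).adicCompletion ℚ)
            (w₀.1.adicCompletion (CyclotomicField (cycLevel p k r) ℚ))))))
      (_hexw : ∀ z : contOneCocycles (localRationalTateRep W p ((galRestrictPlace ((Rat.HeightOneSpectrum.primesEquiv (R := 𝓞 ℚ)).symm ⟨p, Fact.out⟩)).comp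
          (absGaloisRestrict (((Rat.HeightOneSpectrum.primesEquiv (R := 𝓞 ℚ)).symm ⟨p, Fact.out⟩).adicCompletion ℚ)
            (w₀.1.adicCompletion (CyclotomicField (cycLevel p k r) ℚ))))).toTopRep,
        (bdRPeriodRingData (LocalField.valuation_adicCompletion_natCast_lt_one w₀.1 p hw₀)).HasDualExp
          (logCyclotomic p) (localRationalTateRep W p ((galRestrictPlace ((Rat.HeightOneSpectrum.primesEquiv (R := 𝓞 ℚ)).symm ⟨p, Fact.out⟩)).comp
          (absGaloisRestrict (((Rat.HeightOneSpectrum.primesEquiv (R := 𝓞 ℚ)).symm ⟨p, Fact.out⟩).adicCompletion ℚ)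
            (w₀.1.adicCompletion (CyclotomicField (cycLevel p k r) ℚ))))) fun σ => z.1 σ),
      H1 (tateRep W p) (cycSubgroup p k r) →ₗ[ℤ_[p]] ℚ_[p] ⊗[ℚ] CyclotomicField (cycLevel p k r) ℚ :=
  fun dw hinjw hexw =>
    definedLambda W p k r Ψ w₀ (expStarTowerMap W p k r w₀ hw₀ dw hinjw hexw) g hg hΨ
      (expStarTowerMap_smul W p k r w₀ hw₀ dw hinjw hexw)

set_option backward.isDefEq.respectTransparency false in
/-- **(DEF₀) at class level for `katoLambda`**: `Ψ (Λ y)_w = (g̃_w⁻¹)_* (exp*_{w₀} (loc^{tower}_{w₀} (H1toInt (g_w · y))))`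
— by definition. [cite: Kato2004Asterisque, §9.4 (p. 188)] -/
theorem apply_katoLambda :
    letI := LocalField.charZero_adicCompletion w₀.1
    letI := LocalField.adicCompletionPadicAlgebra w₀.1 p hw₀
    haveI : Fact (¬ IsUnit ((p : ℕ) : integerC (w₀.1.adicCompletion (CyclotomicField (cycLevel p k r) ℚ)))) :=
      ⟨not_isUnit_natCast_integerC (LocalField.valuation_adicCompletion_natCast_lt_one w₀.1 p hw₀)⟩
    haveI := isAdicComplete_integerC_natCast (LocalField.valuation_adicCompletion_natCast_lt_one w₀.1 p hw₀)
    ∀ (dw : LocalNeronLine W (LocalField.valuation_adicCompletion_natCast_lt_one w₀.1 p hw₀)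
        ((galRestrictPlace ((Rat.HeightOneSpectrum.primesEquiv (R := 𝓞 ℚ)).symm ⟨p, Fact.out⟩)).comp
          (absGaloisRestrict (((Rat.HeightOneSpectrum.primesEquiv (R := 𝓞 ℚ)).symm ⟨p, Fact.out⟩).adicCompletion ℚ)
            (w₀.1.adicCompletion (CyclotomicField (cycLevel p k r) ℚ)))))
      (hinjw : (bdRPeriodRingData (LocalField.valuation_adicCompletion_natCast_lt_one w₀.1 p hw₀)).CupLogInjective
        (logCyclotomic p) (localRationalTateRep W p ((galRestrictPlace ((Rat.HeightOneSpectrum.primesEquiv (R := 𝓞 ℚ)).symm ⟨p, Fact.out⟩)).comp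
          (absGaloisRestrict (((Rat.HeightOneSpectrum.primesEquiv (R := 𝓞 ℚ)).symm ⟨p, Fact.out⟩).adicCompletion ℚ)
            (w₀.1.adicCompletion (CyclotomicField (cycLevel p k r) ℚ))))))
      (hexw : ∀ z : contOneCocycles (localRationalTateRep W p ((galRestrictPlace ((Rat.HeightOneSpectrum.primesEquiv (R := 𝓞 ℚ)).symm ⟨p, Fact.out⟩)).comp
          (absGaloisRestrict (((Rat.HeightOneSpectrum.primesEquiv (R := 𝓞 ℚ)).symm ⟨p, Fact.out⟩).adicCompletion ℚ)
            (w₀.1.adicCompletion (CyclotomicField (cycLevel p k r) ℚ))))).toTopRep,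
        (bdRPeriodRingData (LocalField.valuation_adicCompletion_natCast_lt_one w₀.1 p hw₀)).HasDualExp
          (logCyclotomic p) (localRationalTateRep W p ((galRestrictPlace ((Rat.HeightOneSpectrum.primesEquiv (R := 𝓞 ℚ)).symm ⟨p, Fact.out⟩)).comp
          (absGaloisRestrict (((Rat.HeightOneSpectrum.primesEquiv (R := 𝓞 ℚ)).symm ⟨p, Fact.out⟩).adicCompletion ℚ)
            (w₀.1.adicCompletion (CyclotomicField (cycLevel p k r) ℚ))))) fun σ => z.1 σ)
      (y : H1 (tateRep W p) (cycSubgroup p k r))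
      (w : ((Rat.HeightOneSpectrum.primesEquiv (R := 𝓞 ℚ)).symm ⟨p, Fact.out⟩).Extension
        (𝓞 (CyclotomicField (cycLevel p k r) ℚ))),
      Ψ (katoLambda W p k r w₀ Ψ hΨ hw₀ g hg dw hinjw hexw y) w = galAdicCompletionMap
        (sigma (cycLevel p k r) (modNCyclotomicCharacter ℚ (cycLevel p k r) (g w)))⁻¹
        (inv_smul_eq_of_smul_eq (hg w))
        (expStarTowerMap W p k r w₀ hw₀ dw hinjw hexw (conjMap (tateRep W p).toTopRep (cycSubgroup p k r) (g w) 1 y)) :=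
  fun dw hinjw hexw y w => apply_definedLambda W p k r Ψ w₀ (expStarTowerMap W p k r w₀ hw₀ dw hinjw hexw) g hg hΨ
    (expStarTowerMap_smul W p k r w₀ hw₀ dw hinjw hexw) y w

end ExpStar



end Summit.BirchSwinnertonDyer.BirchSwinnertonDyer.Theorems.KimAtThreeFineKatoDefinedLambda

end
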